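import Literature.AnabelianGeometry.SemiGraphs.QuasiTemperoidsThmA4CechExtension
import Literature.AnabelianGeometry.SemiGraphs.CechNerveFunctor
import Literature.AnabelianGeometry.SemiGraphs.BTempCechNerve
import HarnessLib

/-!
# Semi-graphs of anabelioids, Appendix, Theorem A.4 (Čech route): the three typings of the Čech nerve
# in the tree coincide definitionally

Mochizuki, *Semi-graphs of anabelioids*, Publ. RIMS **42** (2006) 221–322, Appendix, Theorem A.4
(manuscript pp. 82–86) [cite: MochizukiSemiAnbd2006, Thm A.4 pp.82-86].  PROOF-ONLY bookkeeping for row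
A4-∃ of `plan/L3/SUBDAG-SemiAnbd-Cor311.md` (abc-iut-L3-t5, E2): the truncated Čech nerve
`X ↦ ((X ⨯ A) ⨯ A ⇉ X ⨯ A)` valued in `C[A]` was typed three times during the parallel build-out —
`ThmA4Cech.nerve` (`QuasiTemperoidsThmA4CechExtension.lean`), `CechSq.nerve` (`CechNerveFunctor.lean`,
abc-iut-w5-d129) and, at `B^temp(Π)`, `BTemp.cechPair` (`BTempCechNerve.lean`, abc-iut-w5-d220).  They
AGREE ON THE NOSE (`rfl`), hence so do the Čech extensions `Ψ = colim ∘ (H ∘ nerve)`; a finite-limit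
theorem (E3) proved against any of the three applies verbatim to `ThmA4Cech.Ψ`, the functor consumed by
`ThmA4Cech.thmA4_of_cechFiniteLimits` (`QuasiTemperoidsThmA4CechReduction.lean`, abc-iut-w5-d220).
Nothing here refers to the IUT corpus; no side is taken on any disputed claim.
-/


open CategoryTheory CategoryTheory.Limits

namespace Literature.AnabelianGeometry.SemiGraphs

namespace ThmA4Cech

universe v₁ v₃ u u₁ u₃

/-! ### The three nerves in the tree agree on the nose -/

section Generic

variable {C : Type u₁} [Category.{v₁} C] [HasBinaryProducts C] (A : C)

/-- `ThmA4Cech.nerve` IS `CechSq.nerve` (abc-iut-w5-d129's `CechNerveFunctor.lean`): same objects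
`⟨(X ⨯ A) ⨯ A, pr₂⟩ ⇉ ⟨X ⨯ A, pr₂⟩`, same faces `pr₁`, `pr₁ ⨯ 𝟙_A`, same action on arrows.
[cite: MochizukiSemiAnbd2006, Thm A.4 pp.82-86] -/
theorem nerve_eq_cechSqNerve : nerve A = CechSq.nerve A := rfl

/-- Hence the two Čech extensions are the same functor. [cite: MochizukiSemiAnbd2006, Thm A.4 pp.82-86] -/
theorem Ψ_eq_cechSq {C' : Type u₃} [Category.{v₃} C'] (H : Over' A ⥤ C')
    [HasColimitsOfShape WalkingParallelPair C'] :
    Ψ A H = (CechSq.nerve A ⋙ (Functor.whiskeringRight WalkingParallelPair (Over' A) C').obj H) ⋙ colim :=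
  rfl

end Generic

/-! ### At `B^temp(Π)` -/

section BTemp

variable {G : Type u} [Group G] [TopologicalSpace G] [HasFiniteLimits (BTemp G)] (A : BTemp G)

/-- At `B^temp(Π)`, `ThmA4Cech.nerve A` IS abc-iut-w5-d220's `BTemp.cechPair A` (`BTempCechNerve.lean`).
[cite: MochizukiSemiAnbd2006, Thm A.4 pp.82-86] -/
theorem nerve_eq_cechPair : nerve A = BTemp.cechPair A := rfl

/-- Hence `Ψ A H = (BTemp.cechPair A ⋙ − ∘ H) ⋙ colim`, the holder's Ψ-term.
[cite: MochizukiSemiAnbd2006, Thm A.4 pp.82-86] -/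
theorem Ψ_eq_cechPair {C' : Type u₃} [Category.{v₃} C'] (H : Over' A ⥤ C')
    [HasColimitsOfShape WalkingParallelPair C'] :
    Ψ A H = (BTemp.cechPair A ⋙ (Functor.whiskeringRight WalkingParallelPair (Over' A) C').obj H) ⋙
      colim :=
  rfl

end BTemp

end ThmA4Cech

end Literature.AnabelianGeometry.SemiGraphs
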